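import Mathlib.LinearAlgebra.Dual.Lemmas
import Literature.NumberTheory.Automorphic.GKModules
import HarnessLib

/-!
# Sub- and quotient `(𝔤, K)`-modules

Topic `NumberTheory/Automorphic`; namespace `Literature.NumberTheory.Automorphic.GKSubmodule`.
Two definitions with bodies (the induced infinitesimal actions) and theorems; no named fact,
no `sorry`.

For `(𝔤, K)`-module data `(ρK, ρ𝔤)` on `V` (`IsGKModule G ρK ρ𝔤`, `GKModules`) and a
`ℂ`-subspace `U ≤ V` stable under `K` (`hK : ∀ k, U ≤ U.comap (ρK k)`) and under `𝔤`
(`h𝔤 : ∀ X, U ≤ U.comap (ρ𝔤 X)`):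

* the `K`-actions on `U` and `V ⧸ U` are Mathlib's `ρK.subrepresentation U hK`,
  `ρK.quotient U hK`; the `𝔤`-actions are `GKSubmodule.subLie G ρ𝔤 U h𝔤`,
  `GKSubmodule.quotLie G ρ𝔤 U h𝔤` (`coe_subLie_apply`, `quotLie_mk`);
* `GKSubmodule.isGKModule_sub`, `GKSubmodule.isGKModule_quot` — **`U` and `V ⧸ U` are
  `(𝔤, K)`-modules** [cite: KnappVogan1995, §I.3–I.4, (1.86)] (locally `K`-finite representations
  pass to subrepresentations and quotients) [cite: BorelWallach2000, 0 §2.5]: `K`-finiteness is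
  inherited,
  `Ad`-compatibility restricts / descends, and weak continuity / the weak derivative
  along `𝔨` reduce to `V` because functionals on `U` extend to `V`
  (`Subspace.dualRestrict_surjective`) and functionals on `V ⧸ U` pull back to `V`.

## Mathlib / Literature search

`Representation.subrepresentation`, `Representation.quotient`, `Submodule.mapQ`,
`Subspace.dualRestrict_surjective` (Mathlib) are used; Mathlib has no `(𝔤, K)`-modules
(`IsGKModule` is the tree's). Nothing here duplicates an existing declaration
(`lean search 'isGKModule_sub|isGKModule_quot|subLie|quotLie'`: no hits).

## References

* A. W. Knapp, D. A. Vogan, *Cohomological Induction and Unitary Representations* (1995),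
  §I.3–I.4, (1.86) (held) [KnappVogan1995].
* A. Borel, N. Wallach (2000), 0 §2.5 (held) [BorelWallach2000].
-/

noncomputable section

namespace Literature.NumberTheory.Automorphic

open Module

-- Mathlib idiom (as in `GKModules`): commutator bracket on `Module.End`
attribute [local instance 100] LieRing.ofAssociativeRing

variable {A : Type*} [NormedCommRing A] [NormedAlgebra ℝ A] [NormedAlgebra ℚ A] [CompleteSpace A]
  [StarRing A] {N : Type*} [Fintype N] [DecidableEq N] (G : RealMatrixGroup A N)
  {V : Type*} [AddCommGroup V] [Module ℂ V]
  (ρK : Representation ℂ G.maximalCompact V) (ρ𝔤 : G.lie →ₗ⁅ℝ⁆ Module.End ℂ V)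
  (U : Submodule ℂ V)

namespace GKSubmodule

/-- The infinitesimal action restricted to a `𝔤`-stable subspace. [cite: KnappVogan1995, §I.4] -/
def subLie (h𝔤 : ∀ X : G.lie, U ≤ U.comap (ρ𝔤 X)) : G.lie →ₗ⁅ℝ⁆ Module.End ℂ U where
  toFun X := (ρ𝔤 X).restrict (h𝔤 X)
  map_add' X Y := by
    refine LinearMap.ext fun v => Subtype.ext ?_
    change ρ𝔤 (X + Y) (v : V) = ρ𝔤 X (v : V) + ρ𝔤 Y (v : V)
    rw [map_add, LinearMap.add_apply]
  map_smul' t X := by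
    refine LinearMap.ext fun v => Subtype.ext ?_
    change ρ𝔤 (t • X) (v : V) = (t : ℂ) • ρ𝔤 X (v : V)
    rw [map_smul]
    rfl
  map_lie' {X Y} := by
    refine LinearMap.ext fun v => Subtype.ext ?_
    change ρ𝔤 ⁅X, Y⁆ (v : V) = _
    rw [LieHom.map_lie]
    rfl

/-- Unfolding. [folklore] -/
@[simp] theorem coe_subLie_apply (h𝔤 : ∀ X : G.lie, U ≤ U.comap (ρ𝔤 X)) (X : G.lie) (v : U) :
    (subLie G ρ𝔤 U h𝔤 X v : V) = ρ𝔤 X v := rfl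

/-- The infinitesimal action induced on the quotient by a `𝔤`-stable subspace.
[cite: KnappVogan1995, §I.4] -/
def quotLie (h𝔤 : ∀ X : G.lie, U ≤ U.comap (ρ𝔤 X)) : G.lie →ₗ⁅ℝ⁆ Module.End ℂ (V ⧸ U) where
  toFun X := U.mapQ U (ρ𝔤 X) (h𝔤 X)
  map_add' X Y := by
    refine Submodule.linearMap_qext _ (LinearMap.ext fun v => ?_)
    simp only [map_add, LinearMap.coe_comp, Function.comp_apply, Submodule.mapQ_apply,
      LinearMap.add_apply, Submodule.mkQ_apply, Submodule.Quotient.mk_add]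
  map_smul' t X := by
    refine Submodule.linearMap_qext _ (LinearMap.ext fun v => ?_)
    simp only [LinearMap.coe_comp, Function.comp_apply, Submodule.mkQ_apply, Submodule.mapQ_apply,
      LinearMap.smul_apply, map_smul]
    rfl
  map_lie' {X Y} := by
    refine Submodule.linearMap_qext _ (LinearMap.ext fun v => ?_)
    simp only [LieHom.map_lie, LinearMap.coe_comp, Function.comp_apply, Submodule.mkQ_apply,
      Submodule.mapQ_apply, Ring.lie_def, LinearMap.sub_apply, Module.End.mul_apply,
      Submodule.Quotient.mk_sub]

/-- Unfolding on classes. [folklore] -/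
@[simp] theorem quotLie_mk (h𝔤 : ∀ X : G.lie, U ≤ U.comap (ρ𝔤 X)) (X : G.lie) (v : V) :
    quotLie G ρ𝔤 U h𝔤 X (Submodule.Quotient.mk v) = Submodule.Quotient.mk (ρ𝔤 X v) := rfl

variable [StarModule ℝ A] [ContinuousStar A]

/-- **A `(𝔤, K)`-stable subspace of a `(𝔤, K)`-module is a `(𝔤, K)`-module** (with Mathlib's
`Representation.subrepresentation` and `subLie`): functionals on `U` extend to `V`
(`Subspace.dualRestrict_surjective`), which reduces weak continuity and the weak derivative to
`V`. [cite: KnappVogan1995, §I.3–I.4, (1.86)] [cite: BorelWallach2000, 0 §2.5] -/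
theorem isGKModule_sub (hK : ∀ k : G.maximalCompact, U ≤ U.comap (ρK k))
    (h𝔤 : ∀ X : G.lie, U ≤ U.comap (ρ𝔤 X)) (hV : IsGKModule G ρK ρ𝔤) :
    IsGKModule G (ρK.subrepresentation U hK) (subLie G ρ𝔤 U h𝔤) where
  kFinite u := by
    have hmap : (Submodule.span ℂ
        (Set.range fun k : G.maximalCompact ↦ ρK.subrepresentation U hK k u)).map U.subtype =
        Submodule.span ℂ (Set.range fun k : G.maximalCompact ↦ ρK k u) := by
      rw [Submodule.map_span, ← Set.range_comp]
      rfl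
    haveI := hV.kFinite (u : V)
    have e := Submodule.equivMapOfInjective _ U.injective_subtype
      (Submodule.span ℂ (Set.range fun k : G.maximalCompact ↦ ρK.subrepresentation U hK k u))
    rw [hmap] at e
    exact LinearEquiv.finiteDimensional e.symm
  weaklyContinuous u ℓ := by
    obtain ⟨ℓ', hℓ'⟩ := Subspace.dualRestrict_surjective (W := U) ℓ
    have key : (fun k : G.maximalCompact ↦ ℓ (ρK.subrepresentation U hK k u)) =
        fun k ↦ ℓ' (ρK k u) := by
      funext k
      rw [← hℓ', Submodule.dualRestrict_apply]
      rfl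
    rw [key]
    exact hV.weaklyContinuous u ℓ'
  ad_compat k X := by
    refine LinearMap.ext fun u => Subtype.ext ?_
    exact LinearMap.congr_fun (hV.ad_compat k X) (u : V)
  hasWeakDeriv X u ℓ := by
    obtain ⟨ℓ', hℓ'⟩ := Subspace.dualRestrict_surjective (W := U) ℓ
    have key : (fun t : ℝ ↦ ℓ (ρK.subrepresentation U hK (G.expK (t • X)) u)) =
        fun t ↦ ℓ' (ρK (G.expK (t • X)) u) := by
      funext t
      rw [← hℓ', Submodule.dualRestrict_apply]
      rfl
    have key₂ : ℓ (subLie G ρ𝔤 U h𝔤 (LieSubalgebra.inclusion G.compactLie_le_lie X) u) =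
        ℓ' (ρ𝔤 (LieSubalgebra.inclusion G.compactLie_le_lie X) u) := by
      rw [← hℓ', Submodule.dualRestrict_apply]
      rfl
    rw [key, key₂]
    exact hV.hasWeakDeriv X u ℓ'

/-- **The quotient of a `(𝔤, K)`-module by a `(𝔤, K)`-stable subspace is a `(𝔤, K)`-module**
(Mathlib's `Representation.quotient` and `quotLie`): functionals on `V ⧸ U` pull back to `V`.
[cite: KnappVogan1995, §I.3–I.4, (1.86)] [cite: BorelWallach2000, 0 §2.5] -/
theorem isGKModule_quot (hK : ∀ k : G.maximalCompact, U ≤ U.comap (ρK k))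
    (h𝔤 : ∀ X : G.lie, U ≤ U.comap (ρ𝔤 X)) (hV : IsGKModule G ρK ρ𝔤) :
    IsGKModule G (ρK.quotient U hK) (quotLie G ρ𝔤 U h𝔤) where
  kFinite x := by
    obtain ⟨v, rfl⟩ := Submodule.Quotient.mk_surjective U x
    have hmap : (Submodule.span ℂ (Set.range fun k : G.maximalCompact ↦ ρK k v)).map U.mkQ =
        Submodule.span ℂ (Set.range fun k : G.maximalCompact ↦
          ρK.quotient U hK k (Submodule.Quotient.mk v)) := by
      rw [Submodule.map_span, ← Set.range_comp]
      rfl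
    haveI := hV.kFinite v
    rw [← hmap]
    infer_instance
  weaklyContinuous x ℓ := by
    obtain ⟨v, rfl⟩ := Submodule.Quotient.mk_surjective U x
    exact hV.weaklyContinuous v (ℓ ∘ₗ U.mkQ)
  ad_compat k X := by
    refine Submodule.linearMap_qext _ (LinearMap.ext fun v => ?_)
    simp only [LinearMap.coe_comp, Function.comp_apply, Submodule.mkQ_apply,
      Representation.quotient_apply, Submodule.mapQ_apply, quotLie_mk]
    have e := LinearMap.congr_fun (hV.ad_compat k X) v
    simp only [LinearMap.coe_comp, Function.comp_apply] at e
    rw [e]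
  hasWeakDeriv X x ℓ := by
    obtain ⟨v, rfl⟩ := Submodule.Quotient.mk_surjective U x
    exact hV.hasWeakDeriv X v (ℓ ∘ₗ U.mkQ)

end GKSubmodule

end Literature.NumberTheory.Automorphic
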